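import Summits.ValiantsHypothesis.ValiantsHypothesis.Theorems.DepthWindowTopBracketDefs
import HarnessLib

/-!
# Route `DepthWindow` — top bracket of the product-depth dial, part 2/5: the `K`-fold expansion sums and halves

Decomp-valiant workshop, lens 4, generation 48 (cell O32).  Route-independent, definition-free.  Properties of
the definitions of part 1 §1: the total step `exp1` and the `K`-fold distributed expansion `expandIter K` of an
atom SUM to the value of the atom (`expandIter_sum`), every atom they produce has formal degree `≤ 1` or at
most a `2^K`-th of the expanded atom's (`expandIter_deg`, `×`-balance), every term has `≤ 5^K` atoms
(`expandIter_length_le`) and there are `≤ (#ι²)^(iterExp K)` terms (`length_expandIter_le`, `iterExp K ≤ 5^K`).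
These four facts are exactly the fields of the one-level `Scheme` of part 1 §2 for the instance
`(expandIter K, (#ι²)^(iterExp K), 5^K, 2^K)` used in part 4.  Nothing here bears on `VP ≠ VNP`; 0 sorry.

References: [ValiantSkyumBerkowitzRackoff1983]; [Burgisser2000TCS] Thm. 2.5; [Tavenas2015] §4 Def. 4, §5 Prop. 3;
[AgrawalVinay2008]; [LimayeSrinivasanTavenas2025] §1 (product depth).
-/

-- layout Summits/ValiantsHypothesis/ValiantsHypothesis forces the duplicated namespace component
set_option linter.dupNamespace false

noncomputable section

open MvPolynomial Literature.Computability.AlgebraicComplexity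
open Literature.Computability.AlgebraicComplexity.DepthReduction ArithCircuit
open Literature.Computability.AlgebraicComplexity.DepthReduction.HomCircuit (Atom termWidth)

namespace Summit.ValiantsHypothesis.ValiantsHypothesis.Theorems.DepthWindow

namespace TopBracket

universe u v w

variable {k : Type u} {σ : Type v} {ι : Type w} [CommSemiring k]

/-! ## §0 List bookkeeping -/

section ListLemmas

/-- Length of a `flatMap`, blockwise. [folklore] -/
theorem length_flatMap_eq {α β : Type*} (L : List α) (f : α → List β) :
    (L.flatMap f).length = (L.map fun a => (f a).length).sum := by
  induction L with
  | nil => simp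
  | cons a L ih => simp [List.flatMap_cons, ih]

end ListLemmas

/-! ## §1 The `K`-fold `×`-balanced expansion of an atom -/

section Expansion

/-- An atom lives over a nonempty node type. [folklore] -/
theorem nonempty_of_atom (a : Atom ι) : Nonempty ι := by
  cases a with
  | node ν => exact ⟨ν⟩
  | quot ν _ => exact ⟨ν⟩

/-- `#ι² ≥ 1` as soon as there is an atom. [folklore] -/
theorem one_le_termWidth [Fintype ι] (a : Atom ι) : 1 ≤ termWidth ι := by
  haveI := nonempty_of_atom a
  show 1 ≤ Fintype.card ι * Fintype.card ι
  exact Nat.succ_le_of_lt (Nat.mul_pos Fintype.card_pos Fintype.card_pos)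

variable (H : HomCircuit k σ ι) [DecidableEq ι] [Fintype ι]

/-- The total step sums to the value of the atom. [cite: Tavenas2015, §5 (proof of Prop. 3)] -/
theorem exp1_sum (a : Atom ι) : ((exp1 H a).map H.tval).sum = H.aval a := by
  unfold exp1
  split_ifs with h
  · exact H.expandAtom_sum h
  · simp

omit [DecidableEq ι] in
/-- `×`-balance of the total step: every atom produced has formal degree `≤ 1` or at most half the
expanded atom's. [cite: Tavenas2015, §4 Def. 4, §5 Prop. 3] -/
theorem exp1_half (a : Atom ι) :
    ∀ T ∈ exp1 H a, ∀ b ∈ T, H.adeg b ≤ 1 ∨ 2 * H.adeg b ≤ H.adeg a := by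
  intro T hT b hb
  unfold exp1 at hT
  split_ifs at hT with h
  · exact Or.inr (H.expandAtom_half hT b hb)
  · simp only [List.mem_singleton] at hT
    subst hT
    simp only [List.mem_singleton] at hb
    subst hb
    exact Or.inl (by omega)

omit [DecidableEq ι] in
/-- Every term of the total step has at most `5` atoms. [cite: Tavenas2015, §4 Def. 4] -/
theorem exp1_length_le (a : Atom ι) : ∀ T ∈ exp1 H a, T.length ≤ 5 := by
  intro T hT
  unfold exp1 at hT
  split_ifs at hT with h
  · exact H.expandAtom_length_le hT
  · simp only [List.mem_singleton] at hT
    subst hT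
    simp

omit [DecidableEq ι] in
/-- The total step has at most `#ι²` terms. [cite: Tavenas2015, §5 (proof of Prop. 3)] -/
theorem length_exp1_le (a : Atom ι) : (exp1 H a).length ≤ termWidth ι := by
  unfold exp1
  split_ifs with h
  · exact H.length_expandAtom_le a
  · simpa using one_le_termWidth a

omit [Fintype ι] in
/-- Distributivity: the concatenations sum to the product of the sums. [folklore] -/
theorem cart_sum : ∀ Ls : List (List (List (Atom ι))),
    ((cart Ls).map H.tval).sum = (Ls.map fun L => (L.map H.tval).sum).prod
  | [] => by simp [cart]
  | L :: Ls => by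
    rw [cart, List.map_flatMap, sum_flatMap, List.map_cons, List.prod_cons, ← cart_sum Ls,
      ← List.sum_map_mul_right]
    congr 1
    apply List.map_congr_left
    intro T _
    rw [List.map_map]
    have hc : (H.tval ∘ fun U => T ++ U) = fun U => H.tval T * H.tval U := by
      funext U
      simp
    rw [hc, List.sum_map_mul_left]

omit [DecidableEq ι] [Fintype ι] in
/-- Atoms of a concatenation come from the factors. [folklore] -/
theorem forall_mem_cart {P : Atom ι → Prop} : ∀ (Ls : List (List (List (Atom ι)))),
    (∀ L ∈ Ls, ∀ T ∈ L, ∀ b ∈ T, P b) → ∀ U ∈ cart Ls, ∀ b ∈ U, P b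
  | [], _, U, hU, b, hb => by
    simp only [cart, List.mem_singleton] at hU
    subst hU
    simp at hb
  | L :: Ls, h, U, hU, b, hb => by
    simp only [cart, List.mem_flatMap, List.mem_map] at hU
    obtain ⟨T, hT, U', hU', rfl⟩ := hU
    rcases List.mem_append.1 hb with hb | hb
    · exact h L (by simp) T hT b hb
    · exact forall_mem_cart Ls (fun L' hL' => h L' (List.mem_cons.2 (Or.inr hL'))) U' hU' b hb

omit [DecidableEq ι] [Fintype ι] in
/-- Length of a concatenation: at most `F` per factor. [folklore] -/
theorem length_le_of_mem_cart {F : ℕ} : ∀ (Ls : List (List (List (Atom ι)))),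
    (∀ L ∈ Ls, ∀ T ∈ L, T.length ≤ F) → ∀ U ∈ cart Ls, U.length ≤ F * Ls.length
  | [], _, U, hU => by
    simp only [cart, List.mem_singleton] at hU
    subst hU
    simp
  | L :: Ls, h, U, hU => by
    simp only [cart, List.mem_flatMap, List.mem_map] at hU
    obtain ⟨T, hT, U', hU', rfl⟩ := hU
    rw [List.length_append, List.length_cons, Nat.mul_succ]
    have h1 := h L (by simp) T hT
    have h2 := length_le_of_mem_cart Ls (fun L' hL' => h L' (List.mem_cons.2 (Or.inr hL'))) U' hU'
    omega

omit [DecidableEq ι] [Fintype ι] in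
/-- Number of concatenations: the product of the numbers of terms. [folklore] -/
theorem length_cart_le {W : ℕ} : ∀ (Ls : List (List (List (Atom ι)))),
    (∀ L ∈ Ls, L.length ≤ W) → (cart Ls).length ≤ W ^ Ls.length
  | [], _ => by simp [cart]
  | L :: Ls, h => by
    rw [cart, length_flatMap_eq, List.length_cons, pow_succ']
    have hc := length_cart_le Ls (fun L' hL' => h L' (List.mem_cons.2 (Or.inr hL')))
    have hL := h L (by simp)
    calc (L.map fun T => ((cart Ls).map fun U => T ++ U).length).sum
        ≤ L.length * (cart Ls).length := by
          have h5 := List.sum_le_card_nsmul (L.map fun T => ((cart Ls).map fun U => T ++ U).length)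
            (cart Ls).length fun x hx => by
              obtain ⟨T, -, rfl⟩ := List.mem_map.1 hx
              rw [List.length_map]
          rwa [List.length_map, smul_eq_mul] at h5
      _ ≤ W * W ^ Ls.length := Nat.mul_le_mul hL hc

/-- The distributed step sums to the value of the term. [folklore] -/
theorem expandTerm_sum (T : List (Atom ι)) : ((expandTerm H T).map H.tval).sum = H.tval T := by
  rw [expandTerm, cart_sum, List.map_map]
  unfold HomCircuit.tval
  congr 1
  apply List.map_congr_left
  intro a _
  exact exp1_sum H a

/-- The `K`-fold expansion sums to the value of the atom. [cite: Tavenas2015, §5 (proof of Prop. 3)] -/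
theorem expandIter_sum : ∀ (K : ℕ) (a : Atom ι), ((expandIter H K a).map H.tval).sum = H.aval a
  | 0, a => by simp [expandIter]
  | K + 1, a => by
    rw [expandIter, List.map_flatMap, sum_flatMap]
    have h : (fun T => ((expandTerm H T).map H.tval).sum) = H.tval := by
      funext T
      exact expandTerm_sum H T
    rw [h]
    exact expandIter_sum K a

omit [DecidableEq ι] in
/-- `×`-balance of the `K`-fold expansion: every atom produced has formal degree `≤ 1` or at most a
`2^K`-th of the expanded atom's. [cite: Tavenas2015, §4 Def. 4, §5 Prop. 3] -/
theorem expandIter_deg : ∀ (K : ℕ) (a : Atom ι), ∀ T ∈ expandIter H K a, ∀ b ∈ T,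
    H.adeg b ≤ 1 ∨ 2 ^ K * H.adeg b ≤ H.adeg a
  | 0, a, T, hT, b, hb => by
    simp only [expandIter, List.mem_singleton] at hT
    subst hT
    simp only [List.mem_singleton] at hb
    subst hb
    exact Or.inr (by simp)
  | K + 1, a, T, hT, b, hb => by
    simp only [expandIter, List.mem_flatMap] at hT
    obtain ⟨T₀, hT₀, hT⟩ := hT
    have ih := expandIter_deg K a T₀ hT₀
    refine forall_mem_cart (P := fun b => H.adeg b ≤ 1 ∨ 2 ^ (K + 1) * H.adeg b ≤ H.adeg a)
      (T₀.map (exp1 H)) ?_ T hT b hb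
    intro L hL T' hT' b' hb'
    obtain ⟨c, hc, rfl⟩ := List.mem_map.1 hL
    rcases exp1_half H c T' hT' b' hb' with h1 | h2
    · exact Or.inl h1
    · rcases ih c hc with h3 | h4
      · exact Or.inl (by omega)
      · right
        calc 2 ^ (K + 1) * H.adeg b' = 2 ^ K * (2 * H.adeg b') := by ring
          _ ≤ 2 ^ K * H.adeg c := Nat.mul_le_mul_left _ h2
          _ ≤ H.adeg a := h4

omit [DecidableEq ι] in
/-- Every term of the `K`-fold expansion has at most `5^K` atoms. [cite: Tavenas2015, §4 Def. 4] -/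
theorem expandIter_length_le : ∀ (K : ℕ) (a : Atom ι), ∀ T ∈ expandIter H K a, T.length ≤ 5 ^ K
  | 0, a, T, hT => by
    simp only [expandIter, List.mem_singleton] at hT
    subst hT
    simp
  | K + 1, a, T, hT => by
    simp only [expandIter, List.mem_flatMap] at hT
    obtain ⟨T₀, hT₀, hT⟩ := hT
    have h0 := expandIter_length_le K a T₀ hT₀
    have h := length_le_of_mem_cart (F := 5) (T₀.map (exp1 H)) (fun L hL T' hT' => by
      obtain ⟨c, -, rfl⟩ := List.mem_map.1 hL
      exact exp1_length_le H c T' hT') T hT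
    rw [List.length_map] at h
    calc T.length ≤ 5 * T₀.length := h
      _ ≤ 5 * 5 ^ K := Nat.mul_le_mul_left _ h0
      _ = 5 ^ (K + 1) := by ring

/-- `Σ_{i<K} 5^i ≤ 5^K`. [folklore] -/
theorem iterExp_le (K : ℕ) : iterExp K ≤ 5 ^ K := by
  induction K with
  | zero => simp [iterExp]
  | succ K ih =>
    rw [iterExp, pow_succ]
    omega

omit [DecidableEq ι] in
/-- The `K`-fold expansion has at most `(#ι²)^{Σ_{i<K} 5^i}` terms. [cite: AgrawalVinay2008] -/
theorem length_expandIter_le : ∀ (K : ℕ) (a : Atom ι),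
    (expandIter H K a).length ≤ termWidth ι ^ iterExp K
  | 0, a => by simp [expandIter, iterExp]
  | K + 1, a => by
    have hw := one_le_termWidth (ι := ι) a
    rw [expandIter, length_flatMap_eq, iterExp, pow_add]
    calc ((expandIter H K a).map fun T => (expandTerm H T).length).sum
        ≤ (expandIter H K a).length * termWidth ι ^ 5 ^ K := by
          have h5 := List.sum_le_card_nsmul ((expandIter H K a).map fun T => (expandTerm H T).length)
            (termWidth ι ^ 5 ^ K) fun x hx => by
              obtain ⟨T, hT, rfl⟩ := List.mem_map.1 hx
              rw [expandTerm]
              refine (length_cart_le (W := termWidth ι) _ fun L hL => ?_).trans ?_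
              · obtain ⟨c, -, rfl⟩ := List.mem_map.1 hL
                exact length_exp1_le H c
              · rw [List.length_map]
                exact Nat.pow_le_pow_right hw (expandIter_length_le H K a T hT)
          rwa [List.length_map, smul_eq_mul] at h5
      _ ≤ termWidth ι ^ iterExp K * termWidth ι ^ 5 ^ K :=
          Nat.mul_le_mul_right _ (length_expandIter_le K a)

end Expansion

end TopBracket

end Summit.ValiantsHypothesis.ValiantsHypothesis.Theorems.DepthWindow

end
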